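/-
Origin: expansion seat `prover-pub-hodgecm-mc-discharge-4-g6-0`, handover #1 16:50Z md5 ba548740fc33 (399 l.; NEW additive KERNEL leaf, ns HodgeCM.Model.HypCensus; imports `HodgeCM.Model.HypCensus.ArchDatumPlacesCMSigns` (D-3 #5) + `HodgeCM.Vendored.H21.NumberTheory.Weil1964.ArchFollandDualPairDefinitePlaceSlice` + `HodgeCM.Vendored.H21.NumberTheory.GelbartRogawski1991.CompatibleSplittingTwistVacuumShift`; 0 defs / 0 records / 0 cited hypotheses / 0 `local notation`, 9 theorems: §1 `exists_forall_cmArchWeilRep_archSingle_one_eq_det_zpow_smul` (any frames: `hW : IsArchWeilDatum (archPairPhaseHom …) (repTransport (scaledFrame …) (cmArchWeilRep …))` + `IsEmpty (P b) ∨ IsEmpty (Q b)` ⇒ `∃ m, ∀ u G Φ∞, G free of b → frame image of Φ∞ = binvPi G → cmArchWeilRep (archSingle (cmPlaceOver L b) u, 1) Φ∞ = det(u)^m • Φ∞`; = tree p190938 §4 with `hϖ := rfl`), §2 `isEmpty_posIdx_or_negIdx_placeSignVec` (sign facts `hV` ⇒ V definite in the canonical frame at every real b not under ι₁), `signs_fin_one`,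 `signs_fin_one'` (M = 1 discharge of `h₁W`/`hW`), `exists_exponent_of_signs` (hyps `(ι₁ h₁V h₁W hV hW)` of `hasThetaMajorants_cmPairSplitting_of_signs` VERBATIM ⇒ ONE function `a : {v real} → ℤ` of raw exponents at all real b ≠ place of ι₁, via D-3 #5 `isArchWeilDatum_repTransport_cmArchWeilRep_of_signs`), §3 `cmPairRep_archSingle_one_tmul_eq_det_zpow_smul` (adelic currency on `E(Φ∞ ⊗ f)` via binder-2 `omega_cmPairSplitting_arch_map_tmul`), §4 `cmPairRepTwist_archSingle_one_tmul_eq_zpow_smul` / `…_eq_self` ((S-norm) via p188957: exponent `m + nV (w b)`, FIXED when `nV (w b) = −m`), §5 headline `exists_exponent_twist_eq_self_of_signs` (∃ a, ∀ χV χW nV, HasArchType χV nV → ∀ b not under ι₁, nV (cmPlaceOver L b) = −a b → every vacuum-at-b pure tensor is FIXED by `cmPairRepTwist hGR (cmDetTwistChar χV χW) ((archSingle (w b) u)^𝔸, 1)`). MODEL-N ±0, E unchanged; binder-2 / D-3 bytes untouched (imports only). EVIDENCE: hub-farm `lean check` rc 0 / 0 sorries / 0 warnings (66.8 s, 16:45Z;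 re-run 16:47Z, 16:49Z) of the concatenation `mc/pub-hodgecm-mc-discharge-4/stage/g6/check_c5_concat.lean` 29f8d21f5483 (= D-3 `notes/check_pin_concat_treeimports.lean` e510f4a81425 ++ p190938 inlined (farm olean not yet built) ++ this body, imports de-vendored; log `stage/g6/check_c5_concat.log` 9797ff1237d8); `#print axioms` of `exists_exponent_twist_eq_self_of_signs`, `exists_exponent_of_signs`, `cmPairRepTwist_archSingle_one_tmul_eq_zpow_smul` = [propext, Classical.choice, Quot.sound]. No private `lake` build from this seat.) (`HOME/mc/pub-hodgecm-mc-discharge-4/stage/HodgeCM/Model/HypCensus/DefiniteVacuumExponent.lean`, md5 ba548740, 399 lines);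
landed by the gen-12 packager (p-g12) in gate run 36 as `HodgeCM/Model/HypCensus/DefiniteVacuumExponent.lean` (verbatim).
-/
/-
Origin: speedrun cell pub-hodgecm, MODEL-CONSTRUCTION sub-cell, discharge seat mc-discharge-4 (unit pub-hodgecm-mc-discharge-4,
seat prover-pub-hodgecm-mc-discharge-4-g6-0, gen 6), ticket D-5 = BINDER-OWNERS §1a row 10 `C` / §1c row 12, sub-item (c5) =
(C-fix∞⊥) under the rulings (S-norm) (BINDER-TRIAGE §62.3) and (η-split) (model1, STATUS 2026-08-19T15:38:18Z): the PKG HALF,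
authored under binder-2's custody (CUSTODY WORD STATUS 2026-08-19T13:37:10Z), 2026-08-19.
Target in PKG: `HodgeCM/Model/HypCensus/DefiniteVacuumExponent.lean` (NEW additive leaf; imports D-3 kit r3 row #5
`ArchDatumPlacesCMSigns` (→ #4 `ArchDatumPlacesCM` → #3 `ArchDatumPlaces` → binder-2 `ArchDatumCM` 6b7b14981f04) and the K-1
twins of the tree files `Weil1964/ArchFollandDualPairDefinitePlaceSlice` (p190938, 38f93236b7d2) and
`GelbartRogawski1991/CompatibleSplittingTwistVacuumShift` (p188957)).  KERNEL only: 0 definitions / records / named facts /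
cited hypotheses, 0 proof holes.  Checked against the hub tree by concatenation with `ArchFactor` 55e596e2a0dc / `ArchDatum`
13e0d54cb896 / `ArchDatumCoeff` cf854e6a9240 / `ArchDatumLift` f72d05db6f7c / `ArchDatumPlaces` ed5134ac1dcf / `ArchDatumCM`
6b7b14981f04 / `ArchDatumPlacesCM` d16eec1fb116 / `ArchDatumPlacesCMSigns` 6a79464afb75 (imports de-vendored), farm rc 0.
-/
import Summits.HodgeConjecture.HodgeCM.Model.HypCensus.ArchDatumPlacesCMSigns
import Literature.NumberTheory.Weil1964.ArchFollandDualPairDefinitePlaceSlice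
import Literature.NumberTheory.GelbartRogawski1991.CompatibleSplittingTwistVacuumShift

/-!
# Census kit, sub-item (c5) = (C-fix∞⊥): the vacuum exponent of the CM pin at a DEFINITE place, and its normalisation

The CM dual pair `(U(diag d_V), U(diag d_W))` over `L/L⁺` (`N`, `M` arbitrary: the big pair `M = 2` of `wmInputCM₂s` AND the
two line pairs `M = 1` of the `S`-term), its chosen compatible splitting `s = cmSplittingOf hGR`
([GelbartRogawski1991, Prop. 3.1.1]) and binder-2's archimedean Weil representation `cmArchWeilRep L e dV … hGR` of
`U(diag d_V)(L ⊗ ℝ) × U(diag d_W)(L ⊗ ℝ)` on `𝓢((L⁺ ⊗ ℝ)^n)` (`ArchDatumCM`; `ω_ψ(s_pair(x_∞, y_∞))(E(Φ_∞ ⊗ Φ_f)) =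
E(cmArchWeilRep (x, y) Φ_∞ ⊗ Φ_f)`, `omega_cmPairSplitting_arch_map_tmul`).  At a real place `b` of `L⁺` where `V` is DEFINITE
the whole group `U(σ_{w(b)} diag d_V)(ℂ) ≅ U(N)` is compact, and on every test vector that is THE VACUUM AT `b` (frame image
`B⁻¹G` with the Fock polynomial `G` free of the place `b`: any `K`-type vector at the other places) it acts by ONE power of
`det`:

* §1 **`exists_forall_cmArchWeilRep_archSingle_one_eq_det_zpow_smul`** — for ANY frames / scalings in which the (J-arch) datum
  `hW : IsArchWeilDatum (archPairPhaseHom …) (repTransport (scaledFrame …) (cmArchWeilRep …))` is given (D-3 kit rows #4/#5: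
  `isArchWeilDatum_repTransport_cmArchWeilRep`, `…_of_signs`, `…_of_signs_two`) and `IsEmpty (P b) ∨ IsEmpty (Q b)`:
  `∃ m : ℤ, ∀ u, ∀ G free of b, ∀ Φ_∞ with frame image B⁻¹G, cmArchWeilRep (archSingle (w b) u, 1) Φ_∞ = det(u)^m • Φ_∞` — the tree's
  `Weil1964.exists_forall_archSingle_eq_det_zpow_smul_of_repTransport` (p190938 §4) with `hϖ := rfl` (the phase homomorphism
  `archPairPhaseHom` IS `(piPhaseHom (pairFrame …) ι𝕎ᵥ).comp (v ↦ archPairPlace v ∘ archProdHom)`);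
* §2 from SIGN FACTS ONLY (canonical frames `cmSignConv`, the hypotheses `(ι₁ hGR h₁V h₁W hV hW)` of
  `hasThetaMajorants_cmPairSplitting_of_signs` verbatim): at every real place `b` NOT under `ι₁`, `hV` makes `V` definite
  (`isEmpty_posIdx_or_negIdx_placeSignVec`), so the exponent exists there; packaged as ONE function `a : {v real} → ℤ`
  (`exists_exponent_of_signs`; for the line pairs `M = 1` the two `W`-hypotheses are discharged by `signs_fin_one` /
  `signs_fin_one'` — NO hypothesis on a hermitian line — and for the plane `M = 2` `hW` by the tree's `signs_fin_two`);
* §3 adelic currency: `cmPairRep hGR ((archSingle (w b) u)^𝔸, 1) (E(Φ_∞ ⊗ Φ_f)) = det(u)^m • E(Φ_∞ ⊗ Φ_f)`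
  (`cmPairRep_archSingle_one_tmul_eq_det_zpow_smul`);
* §4 (S-norm): for the normalised splitting `s_pair ⊗ ((χ_V ∘ det_V) ⊠ (χ_W ∘ det_W))` with `χ_V` of archimedean type `n_V`,
  the action on such a vector is `det(u)^{m + n_V(w(b))}` (`cmPairRepTwist_archSingle_one_tmul_eq_zpow_smul`) and the vector is
  FIXED when `n_V (w(b)) = −m` (`cmPairRepTwist_archSingle_one_tmul_eq_self`; [GelbartRogawski1991, §3.1 Remark p. 457]:
  no local component of a compatible splitting is pinned, one normalises); headline **`exists_exponent_twist_eq_self_of_signs`**: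
  ONE raw-exponent function `a` such that EVERY normalisation with `n_V (w(b)) = −a b` at the definite places
  fixes every vacuum-at-`b` test vector — the (c5) factor of `ArchKTypeData.fixN` at `w′ ≠ ι₁`, in the currency the RUN-37
  `S`-term consumes ((η-split): `ν⁽ᵏ⁾` of archimedean type `−e_b(line k raw)` at definite `b`; `e_b = a b` here).

What is NOT here (other lanes): the identification of the `b`-factor of theta-3's test vector `Φarch ℓ` as such a `B⁻¹G`
(BRICK 4 junction), the choice of `χ_V` in the `S`-term (period-1; `exists_unitaryLineChar_hasArchType` gives every type), the
`ι₁`-place bookkeeping ((N1)/(hμ), binder-1).  Nothing here is a claim of PerL/QW8.  Provenance of the argument: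
[KonnoKonno2007, §3.1 (3.1)] (the compact member acts on the Fock vacuum by a character), [Folland1989, Prop. (4.39)],
[GelbartRogawski1991, §3.1 Remark p. 457 L4–13], [BorelJacquet1979, §4.1] (`G_∞ = ∏_v G(F_v)`).
-/

set_option autoImplicit false

noncomputable section

open NumberField NumberField.InfinitePlace IsDedekindDomain
open scoped Matrix
open scoped Classical TensorProduct
open Literature.NumberTheory.Automorphic Literature.NumberTheory.Automorphic.UnitaryGroup Literature.NumberTheory.Weil1964
open Literature.RepresentationTheory.KonnoKonno2007 Literature.RepresentationTheory.KonnoKonno2007.RealDualPair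
open Literature.NumberTheory.GelbartRogawski1991 Literature.NumberTheory.GelbartRogawski1991.UnitaryDualPair
open Literature.Analysis.SegalBargmann

namespace HodgeCM.Model.HypCensus

/-! ## §1 The exponent at a definite place, any frames -/

section AnyFrames

variable (L : Type) [Field L] [NumberField L] [IsCMField L] {N M n : ℕ} (e : Fin N × Fin M ≃ Fin n)
variable (dV : Fin N → L) (hdV : ∀ i, IsCMField.complexConj L (dV i) = dV i) (hdV0 : ∀ i, dV i ≠ 0)
variable (dW : Fin M → L) (hdW : ∀ i, IsCMField.complexConj L (dW i) = dW i) (hdW0 : ∀ i, dW i ≠ 0)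
variable (hGR : (cmSplittingDatum L e dV hdV hdV0 dW hdW hdW0).CompatibleSplitting)
variable {P Q R S : {v : InfinitePlace ↥(maximalRealSubfield L) // v.IsReal} → Type} [∀ v, Fintype (P v)]
  [∀ v, DecidableEq (P v)] [∀ v, Fintype (Q v)] [∀ v, DecidableEq (Q v)] [∀ v, Fintype (R v)]
  [∀ v, DecidableEq (R v)] [∀ v, Fintype (S v)] [∀ v, DecidableEq (S v)]

/-- **THE VACUUM EXPONENT OF THE CM PIN AT A DEFINITE PLACE (any frames).**  Given the (J-arch) datum of `cmArchWeilRep` in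
frames `ε_V, ε_W` / scalings `D_V, D_W` (D-3 rows #4/#5) and a real place `b` of `L⁺` at which `V` is definite
(`P b` or `Q b` empty): ONE integer `m` with `cmArchWeilRep (archSingle (w b) u, 1) Φ_∞ = det(u)^m • Φ_∞` for every
`u ∈ U(σ_{w(b)} diag d_V)(ℂ)` and every `Φ_∞` whose frame image is `B⁻¹G` with `G` free of the place `b`.
[KonnoKonno2007, §3.1 (3.1); Folland1989, Prop. (4.39); BorelJacquet1979, §4.1] -/
theorem exists_forall_cmArchWeilRep_archSingle_one_eq_det_zpow_smul
    (εV : ∀ v, Fin N ≃ P v ⊕ Q v) (εW : ∀ v, Fin M ≃ R v ⊕ S v)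
    {DV : {v : InfinitePlace ↥(maximalRealSubfield L) // v.IsReal} → Fin N → ℝ}
    {DW : {v : InfinitePlace ↥(maximalRealSubfield L) // v.IsReal} → Fin M → ℝ}
    (hDV0 : ∀ v i, DV v i ≠ 0) (hDW0 : ∀ v j, DW v j ≠ 0)
    {cV cW : {v : InfinitePlace ↥(maximalRealSubfield L) // v.IsReal} → ℝ} (hcV : ∀ v, cV v ≠ 0)
    (hcW : ∀ v, cW v ≠ 0)
    (htV : ∀ v i, embedding_of_isReal v.2 (cmRealVec L dV hdV i) = cV v * signOf (εV v i) * DV v i ^ 2)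
    (htW : ∀ v j, embedding_of_isReal v.2 (cmRealVec L dW hdW j) = cW v * signOf (εW v j) * DW v j ^ 2)
    (hW : IsArchWeilDatum
      (archPairPhaseHom L (IsCMField.complexConj L) N M e (IsCMField.complexConj_ne_one L) (cmPlaceOver L)
        (cmPlaceOver_smul L) (cmPlaceOver_comap L) (cmRealVec L dV hdV) (cmRealVec L dW hdW)
        (realDiagonal_map L dV hdV).symm (realDiagonal_map L dW hdW).symm εV εW hDV0 hDW0 hcV hcW htV htW)
      (repTransport
        (scaledFrame (↥(maximalRealSubfield L)) (Fin n) (pairScale N M (e := e) DV DW) (pairScale_ne_zero N M hDV0 hDW0))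
        (cmArchWeilRep L e dV hdV hdV0 dW hdW hdW0 hGR)))
    (b : {v : InfinitePlace ↥(maximalRealSubfield L) // v.IsReal}) (hVdef : IsEmpty (P b) ∨ IsEmpty (Q b)) :
    ∃ m : ℤ, ∀ (u : archLocal L N (Matrix.diagonal dV) (cmPlaceOver L b))
      (G : MvPolynomial (Fin n × {v : InfinitePlace ↥(maximalRealSubfield L) // v.IsReal}) ℂ),
      (∀ x ∈ G.vars, x.2 ≠ b) →
        ∀ Φ : SchwartzMap (Fin n → mixedEmbedding.mixedSpace (↥(maximalRealSubfield L))) ℂ,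
          schwartzTransport (scaledFrame (↥(maximalRealSubfield L)) (Fin n) (pairScale N M (e := e) DV DW)
              (pairScale_ne_zero N M hDV0 hDW0)) Φ = binvPi G →
            cmArchWeilRep L e dV hdV hdV0 dW hdW hdW0 hGR
                (archSingle (↥(maximalRealSubfield L)) L (IsCMField.complexConj L) N (Matrix.diagonal dV)
                  (IsCMField.complexConj_ne_one L) (complexConj_smul_infinitePlace L) (cmPlaceOver L b) u, 1) Φ =
              (((u : archLocal L N (Matrix.diagonal dV) (cmPlaceOver L b)) : GL (Fin N) ℂ) :
                  Matrix (Fin N) (Fin N) ℂ).det ^ m • Φ :=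
  exists_forall_archSingle_eq_det_zpow_smul_of_repTransport L (IsCMField.complexConj L) N M
    (IsCMField.complexConj_ne_one L) (cmPlaceOver L) (cmPlaceOver_smul L) (cmPlaceOver_comap L) (cmRealVec L dV hdV)
    (cmRealVec L dW hdW) (realDiagonal_map L dV hdV).symm (realDiagonal_map L dW hdW).symm εV εW hDV0 hDW0 hcV hcW
    htV htW (complexConj_smul_infinitePlace L) b
    (scaledFrame (↥(maximalRealSubfield L)) (Fin n) (pairScale N M (e := e) DV DW) (pairScale_ne_zero N M hDV0 hDW0))
    (fun v => pairFrame (P v) (Q v) (R v) (S v) e (εV v) (εW v))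
    (MonoidHom.pi fun v =>
      (archPairPlace L (IsCMField.complexConj L) N M (IsCMField.complexConj_ne_one L) (cmPlaceOver L)
          (cmPlaceOver_smul L) (cmPlaceOver_comap L) (cmRealVec L dV hdV) (cmRealVec L dW hdW)
          (realDiagonal_map L dV hdV).symm (realDiagonal_map L dW hdW).symm εV εW hDV0 hDW0 hcV hcW htV htW v).comp
        (archProdHom (↥(maximalRealSubfield L)) L (IsCMField.complexConj L) N M (Matrix.diagonal dV)
          (Matrix.diagonal dW)))
    (fun _ _ => rfl) hW hVdef

end AnyFrames

/-! ## §2 From sign facts: the exponent at every real place not under `ι₁` (canonical frames `cmSignConv`) -/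

section SignFacts

variable (L : Type) [Field L] [NumberField L] [IsCMField L]

/-- **At a real place `b` of `L⁺` not under `ι₁`, `V` is definite in the canonical sign frame**: if through every complex
embedding `τ` away from `ι₁` the (real, non-zero) numbers `τ(dᵢ)` have a common strict sign, then the canonical frame
`signSplit (placeSignVec (cmRealVec L d hd) c b)` has no positive or no non-positive index. [folklore] -/
theorem isEmpty_posIdx_or_negIdx_placeSignVec {K : ℕ} (d : Fin K → L) (hd : ∀ i, IsCMField.complexConj L (d i) = d i)
    {c : {v : InfinitePlace ↥(maximalRealSubfield L) // v.IsReal} → ℝ} (hc : ∀ v, c v ≠ 0) (ι₁ : L →+* ℂ)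
    (hV : ∀ τ : L →+* ℂ, InfinitePlace.mk τ ≠ InfinitePlace.mk ι₁ →
      (∀ i, 0 < (τ (d i)).re) ∨ ∀ i, (τ (d i)).re < 0)
    (b : {v : InfinitePlace ↥(maximalRealSubfield L) // v.IsReal})
    (hb : b.1 ≠ (InfinitePlace.mk ι₁).comap (algebraMap (↥(maximalRealSubfield L)) L)) :
    IsEmpty (PosIdx (placeSignVec (cmRealVec L d hd) c b)) ∨ IsEmpty (NegIdx (placeSignVec (cmRealVec L d hd) c b)) := by
  have hτ : (InfinitePlace.mk (cmPlaceOver L b).1.embedding).comap (algebraMap (↥(maximalRealSubfield L)) L) = b.1 := by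
    rw [mk_embedding]; exact cmPlaceOver_comap L b
  have hne : InfinitePlace.mk (cmPlaceOver L b).1.embedding ≠ InfinitePlace.mk ι₁ := by
    intro h; apply hb; rw [← h, mk_embedding, cmPlaceOver_comap]
  rcases forall_pos_or_forall_neg_div (hV _ hne) (hc b) with h | h
  · exact Or.inr (isEmpty_negIdx fun i => by rw [placeSignVec_cmRealVec L b _ hτ]; exact h i)
  · exact Or.inl (isEmpty_posIdx fun i => by rw [placeSignVec_cmRealVec L b _ hτ]; exact h i)

omit [NumberField L] [IsCMField L] in
/-- one non-zero real: it is positive or negative (`M = 1`: a hermitian LINE is definite everywhere). [folklore] -/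
theorem signs_fin_one {y : Fin 1 → ℝ} (hy : ∀ j, y j ≠ 0) : (∀ j, 0 < y j) ∨ ∀ j, y j < 0 := by
  rcases lt_or_gt_of_ne (hy 0) with h | h
  · exact Or.inr fun j => by rw [Subsingleton.elim j 0]; exact h
  · exact Or.inl fun j => by rw [Subsingleton.elim j 0]; exact h

omit [NumberField L] [IsCMField L] in
/-- one real: all but at most one of the entries are positive (vacuously, `M = 1`). [folklore] -/
theorem signs_fin_one' (y : Fin 1 → ℝ) : (∃ j₀ : Fin 1, ∀ j, j ≠ j₀ → 0 < y j) ∨ ∀ j, y j < 0 :=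
  Or.inl ⟨0, fun j hj => absurd (Subsingleton.elim j 0) hj⟩

variable {N M n : ℕ} (e : Fin N × Fin M ≃ Fin n)
variable (dV : Fin N → L) (hdV : ∀ i, IsCMField.complexConj L (dV i) = dV i) (hdV0 : ∀ i, dV i ≠ 0)
variable (dW : Fin M → L) (hdW : ∀ i, IsCMField.complexConj L (dW i) = dW i) (hdW0 : ∀ i, dW i ≠ 0)
variable (hGR : (cmSplittingDatum L e dV hdV hdV0 dW hdW hdW0).CompatibleSplitting)

/-- **THE VACUUM EXPONENTS OF THE CM PIN FROM SIGN FACTS (canonical frames), as ONE function on the real places.**  Under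
the hypotheses `(ι₁ hGR h₁V h₁W hV hW)` of `hasThetaMajorants_cmPairSplitting_of_signs` (verbatim): there is
`a : {v real} → ℤ` such that at every real place `b` NOT under `ι₁` (there `V` is definite by `hV`), for every
`u ∈ U(σ_{w(b)} diag d_V)(ℂ)` and every `Φ_∞` whose image in the canonical scaled Folland frame is `B⁻¹G` with `G` free of `b`:
`cmArchWeilRep (archSingle (w b) u, 1) Φ_∞ = det(u)^{a b} • Φ_∞`.
[KonnoKonno2007, §3.1 (3.1); Folland1989, §4.2 (4.24) p. 156, Prop. (4.39); Knapp2002, Thm 7.39; GelbartRogawski1991, §3.1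
Prop. 3.1.1 p. 455; MoeglinVignerasWaldspurger1987, Ch. 1 I.17; Weil1964, Chap. III n° 37–39; BorelJacquet1979, §4.1] -/
theorem exists_exponent_of_signs (ι₁ : L →+* ℂ)
    (h₁V : ∃ i₀ : Fin N, (∀ i, i ≠ i₀ → 0 < (ι₁ (dV i)).re) ∨ ∀ i, i ≠ i₀ → (ι₁ (dV i)).re < 0)
    (h₁W : (∀ j, 0 < (ι₁ (dW j)).re) ∨ ∀ j, (ι₁ (dW j)).re < 0)
    (hV : ∀ τ : L →+* ℂ, InfinitePlace.mk τ ≠ InfinitePlace.mk ι₁ →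
      (∀ i, 0 < (τ (dV i)).re) ∨ ∀ i, (τ (dV i)).re < 0)
    (hW : ∀ τ : L →+* ℂ, InfinitePlace.mk τ ≠ InfinitePlace.mk ι₁ →
      (∃ j₀ : Fin M, ∀ j, j ≠ j₀ → 0 < (τ (dW j)).re) ∨ ∀ j, (τ (dW j)).re < 0) :
    ∃ a : {v : InfinitePlace ↥(maximalRealSubfield L) // v.IsReal} → ℤ,
      ∀ b : {v : InfinitePlace ↥(maximalRealSubfield L) // v.IsReal},
        b.1 ≠ (InfinitePlace.mk ι₁).comap (algebraMap (↥(maximalRealSubfield L)) L) →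
          ∀ (u : archLocal L N (Matrix.diagonal dV) (cmPlaceOver L b))
            (G : MvPolynomial (Fin n × {v : InfinitePlace ↥(maximalRealSubfield L) // v.IsReal}) ℂ),
            (∀ x ∈ G.vars, x.2 ≠ b) →
              ∀ Φ : SchwartzMap (Fin n → mixedEmbedding.mixedSpace (↥(maximalRealSubfield L))) ℂ,
                schwartzTransport
                    (scaledFrame (↥(maximalRealSubfield L)) (Fin n)
                      (pairScale N M (e := e)
                        (fun v => sqrtAbs (placeSignVec (cmRealVec L dV hdV) (cmSignConv L dV ι₁) v))
                        (fun v => sqrtAbs (placeSignVec (cmRealVec L dW hdW) (fun v =>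
                          ((cmPlaceOver L v).1.embedding (imagUnit L)).im / cmSignConv L dV ι₁ v) v)))
                      (pairScale_ne_zero N M
                        (fun v i => sqrtAbs_ne_zero (div_ne_zero ((map_ne_zero _).2 (ne_zero_of_isUnit_det_diagonal
                          (isUnit_det_realDiagonal L dV hdV hdV0) i)) (cmSignConv_ne_zero L dV ι₁ v)))
                        (fun v j => sqrtAbs_ne_zero (div_ne_zero ((map_ne_zero _).2 (ne_zero_of_isUnit_det_diagonal
                          (isUnit_det_realDiagonal L dW hdW hdW0) j))
                          (div_ne_zero (im_embedding_cmPlaceOver_imagUnit_ne_zero L v) (cmSignConv_ne_zero L dV ι₁ v))))))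
                    Φ = binvPi G →
                  cmArchWeilRep L e dV hdV hdV0 dW hdW hdW0 hGR
                      (archSingle (↥(maximalRealSubfield L)) L (IsCMField.complexConj L) N (Matrix.diagonal dV)
                        (IsCMField.complexConj_ne_one L) (complexConj_smul_infinitePlace L) (cmPlaceOver L b) u, 1) Φ =
                    (((u : archLocal L N (Matrix.diagonal dV) (cmPlaceOver L b)) : GL (Fin N) ℂ) :
                        Matrix (Fin N) (Fin N) ℂ).det ^ a b • Φ := by
  have hW' := isArchWeilDatum_repTransport_cmArchWeilRep_of_signs L e dV hdV hdV0 dW hdW hdW0 hGR ι₁ h₁V h₁W hV hW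
  -- the exponent exists at each real place not under `ι₁` (`V` is definite there by `hV`)
  have hex := fun (b : {v : InfinitePlace ↥(maximalRealSubfield L) // v.IsReal})
      (hb : b.1 ≠ (InfinitePlace.mk ι₁).comap (algebraMap (↥(maximalRealSubfield L)) L)) =>
    exists_forall_cmArchWeilRep_archSingle_one_eq_det_zpow_smul L e dV hdV hdV0 dW hdW hdW0 hGR _ _ _ _
      (cmSignConv_ne_zero L dV ι₁) _ _ _ hW' b
      (isEmpty_posIdx_or_negIdx_placeSignVec L dV hdV (cmSignConv_ne_zero L dV ι₁) ι₁ hV b hb)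
  refine ⟨fun b => if hb : b.1 ≠ (InfinitePlace.mk ι₁).comap (algebraMap (↥(maximalRealSubfield L)) L) then
    (hex b hb).choose else 0, fun b hb => ?_⟩
  simp only [dif_pos hb]
  exact (hex b hb).choose_spec

end SignFacts

/-! ## §3 Adelic currency: the one-place element acts on `E(Φ_∞ ⊗ Φ_f)` by the same power of `det` -/

section Adelic

variable (L : Type) [Field L] [NumberField L] [IsCMField L] {N M n : ℕ} (e : Fin N × Fin M ≃ Fin n)
variable (dV : Fin N → L) (hdV : ∀ i, IsCMField.complexConj L (dV i) = dV i) (hdV0 : ∀ i, dV i ≠ 0)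
variable (dW : Fin M → L) (hdW : ∀ i, IsCMField.complexConj L (dW i) = dW i) (hdW0 : ∀ i, dW i ≠ 0)
variable (hGR : (cmSplittingDatum L e dV hdV hdV0 dW hdW hdW0).CompatibleSplitting)
variable (b : {v : InfinitePlace ↥(maximalRealSubfield L) // v.IsReal})

/-- **Adelic currency.**  If `U(σ_{w(b)} diag d_V)(ℂ)` acts on `Φ_∞` through `cmArchWeilRep (archSingle (w b) ·, 1)` by
`det(u)^m`, then through the raw pair splitting `ω_ψ ∘ s_pair` the one-place element `((archSingle (w b) u)^𝔸, 1)` acts on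
the pure tensor `E(Φ_∞ ⊗ Φ_f)` by `det(u)^m` (`omega_cmPairSplitting_arch_map_tmul` with `y = 1`).
[Weil1964, Chap. III n° 37–38; BorelJacquet1979, §4.1] -/
theorem cmPairRep_archSingle_one_tmul_eq_det_zpow_smul {m : ℤ}
    {Φinf : SchwartzMap (Fin n → mixedEmbedding.mixedSpace (↥(maximalRealSubfield L))) ℂ}
    (hΦ : ∀ u : archLocal L N (Matrix.diagonal dV) (cmPlaceOver L b),
      cmArchWeilRep L e dV hdV hdV0 dW hdW hdW0 hGR
          (archSingle (↥(maximalRealSubfield L)) L (IsCMField.complexConj L) N (Matrix.diagonal dV)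
            (IsCMField.complexConj_ne_one L) (complexConj_smul_infinitePlace L) (cmPlaceOver L b) u, 1) Φinf =
        (((u : archLocal L N (Matrix.diagonal dV) (cmPlaceOver L b)) : GL (Fin N) ℂ) :
            Matrix (Fin N) (Fin N) ℂ).det ^ m • Φinf)
    (f : FinSB (↥(maximalRealSubfield L)) (Fin n)) (u : archLocal L N (Matrix.diagonal dV) (cmPlaceOver L b)) :
    cmPairRep L e dV hdV hdV0 dW hdW hdW0 hGR
        (archToAdelic (↥(maximalRealSubfield L)) L (IsCMField.complexConj L) N (Matrix.diagonal dV)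
          (archSingle (↥(maximalRealSubfield L)) L (IsCMField.complexConj L) N (Matrix.diagonal dV)
            (IsCMField.complexConj_ne_one L) (complexConj_smul_infinitePlace L) (cmPlaceOver L b) u), 1)
        (piSchwartzBruhatEquiv (↥(maximalRealSubfield L)) (Fin n) (Φinf ⊗ₜ[ℂ] f)) =
      (((u : archLocal L N (Matrix.diagonal dV) (cmPlaceOver L b)) : GL (Fin N) ℂ) :
          Matrix (Fin N) (Fin N) ℂ).det ^ m •
        piSchwartzBruhatEquiv (↥(maximalRealSubfield L)) (Fin n) (Φinf ⊗ₜ[ℂ] f) := by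
  -- `ω_ψ(s_pair(x̃_u, 1̃))(E(Φ_∞ ⊗ Φ_f)) = E(cmArchWeilRep (x_u, 1) Φ_∞ ⊗ Φ_f)` (binder-2), `1̃ = 1` (`map_one`)
  have key := omega_cmPairSplitting_arch_map_tmul L e dV hdV hdV0 dW hdW hdW0 hGR
    (archSingle (↥(maximalRealSubfield L)) L (IsCMField.complexConj L) N (Matrix.diagonal dV)
      (IsCMField.complexConj_ne_one L) (complexConj_smul_infinitePlace L) (cmPlaceOver L b) u) 1 Φinf f
  -- (`simp only … at key`, not `rw`: rewriting motives over the pin's adelic pair types are costly to re-check)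
  simp only [map_one, hΦ u, ← TensorProduct.smul_tmul', map_smul] at key
  exact key

end Adelic

/-! ## §4 (S-norm): the normalised splitting shifts the exponent by the archimedean type and FIXES the vector -/

section Twist

variable (L : Type) [Field L] [NumberField L] [IsCMField L] {N M n : ℕ} (e : Fin N × Fin M ≃ Fin n)
variable (dV : Fin N → L) (hdV : ∀ i, IsCMField.complexConj L (dV i) = dV i) (hdV0 : ∀ i, dV i ≠ 0)
variable (dW : Fin M → L) (hdW : ∀ i, IsCMField.complexConj L (dW i) = dW i) (hdW0 : ∀ i, dW i ≠ 0)
variable (hGR : (cmSplittingDatum L e dV hdV hdV0 dW hdW hdW0).CompatibleSplitting)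
variable (χV χW : ContinuousMonoidHom
  (relNormOneIdeles (↥(maximalRealSubfield L)) L ⧸ relNormOneRat (↥(maximalRealSubfield L)) L) Circle)
variable {nV : InfinitePlace L → ℤ}
variable (b : {v : InfinitePlace ↥(maximalRealSubfield L) // v.IsReal})

/-- **The vacuum shift at a definite place, adelic currency**: through `s_pair ⊗ ((χ_V ∘ det_V) ⊠ (χ_W ∘ det_W))`, `χ_V` of
archimedean type `n_V`, the one-place element acts on `E(Φ_∞ ⊗ Φ_f)` by `det(u)^{m + n_V(w(b))}`.
[GelbartRogawski1991, §3.1 Remark p. 457 L4–13] -/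
theorem cmPairRepTwist_archSingle_one_tmul_eq_zpow_smul (hnV : UnitaryLineChar.HasArchType L χV nV) {m : ℤ}
    {Φinf : SchwartzMap (Fin n → mixedEmbedding.mixedSpace (↥(maximalRealSubfield L))) ℂ}
    (hΦ : ∀ u : archLocal L N (Matrix.diagonal dV) (cmPlaceOver L b),
      cmArchWeilRep L e dV hdV hdV0 dW hdW hdW0 hGR
          (archSingle (↥(maximalRealSubfield L)) L (IsCMField.complexConj L) N (Matrix.diagonal dV)
            (IsCMField.complexConj_ne_one L) (complexConj_smul_infinitePlace L) (cmPlaceOver L b) u, 1) Φinf =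
        (((u : archLocal L N (Matrix.diagonal dV) (cmPlaceOver L b)) : GL (Fin N) ℂ) :
            Matrix (Fin N) (Fin N) ℂ).det ^ m • Φinf)
    (f : FinSB (↥(maximalRealSubfield L)) (Fin n)) (u : archLocal L N (Matrix.diagonal dV) (cmPlaceOver L b)) :
    cmPairRepTwist L e dV hdV hdV0 dW hdW hdW0 hGR
        (cmDetTwistChar L dV hdV0 dW hdW0 (charOfUnitaryLineChar L χV) (charOfUnitaryLineChar L χW))
        (archToAdelic (↥(maximalRealSubfield L)) L (IsCMField.complexConj L) N (Matrix.diagonal dV)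
          (archSingle (↥(maximalRealSubfield L)) L (IsCMField.complexConj L) N (Matrix.diagonal dV)
            (IsCMField.complexConj_ne_one L) (complexConj_smul_infinitePlace L) (cmPlaceOver L b) u), 1)
        (piSchwartzBruhatEquiv (↥(maximalRealSubfield L)) (Fin n) (Φinf ⊗ₜ[ℂ] f)) =
      (((u : archLocal L N (Matrix.diagonal dV) (cmPlaceOver L b)) : GL (Fin N) ℂ) :
          Matrix (Fin N) (Fin N) ℂ).det ^ (m + nV (cmPlaceOver L b).1) •
        piSchwartzBruhatEquiv (↥(maximalRealSubfield L)) (Fin n) (Φinf ⊗ₜ[ℂ] f) :=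
  cmPairRepTwist_archSingle_one_eq_zpow_smul L e dV hdV hdV0 dW hdW hdW0 hGR χV χW (cmPlaceOver L b) hnV
    (cmPairRep_archSingle_one_tmul_eq_det_zpow_smul L e dV hdV hdV0 dW hdW hdW0 hGR b hΦ f) u

/-- **… and FIXES `E(Φ_∞ ⊗ Φ_f)` when the type at `w(b)` is opposite to the raw exponent: `n_V (w(b)) = −m`.**
[GelbartRogawski1991, §3.1 Remark p. 457 L4–13] -/
theorem cmPairRepTwist_archSingle_one_tmul_eq_self (hnV : UnitaryLineChar.HasArchType L χV nV) {m : ℤ}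
    {Φinf : SchwartzMap (Fin n → mixedEmbedding.mixedSpace (↥(maximalRealSubfield L))) ℂ}
    (hΦ : ∀ u : archLocal L N (Matrix.diagonal dV) (cmPlaceOver L b),
      cmArchWeilRep L e dV hdV hdV0 dW hdW hdW0 hGR
          (archSingle (↥(maximalRealSubfield L)) L (IsCMField.complexConj L) N (Matrix.diagonal dV)
            (IsCMField.complexConj_ne_one L) (complexConj_smul_infinitePlace L) (cmPlaceOver L b) u, 1) Φinf =
        (((u : archLocal L N (Matrix.diagonal dV) (cmPlaceOver L b)) : GL (Fin N) ℂ) :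
            Matrix (Fin N) (Fin N) ℂ).det ^ m • Φinf)
    (hn : nV (cmPlaceOver L b).1 = -m) (f : FinSB (↥(maximalRealSubfield L)) (Fin n))
    (u : archLocal L N (Matrix.diagonal dV) (cmPlaceOver L b)) :
    cmPairRepTwist L e dV hdV hdV0 dW hdW hdW0 hGR
        (cmDetTwistChar L dV hdV0 dW hdW0 (charOfUnitaryLineChar L χV) (charOfUnitaryLineChar L χW))
        (archToAdelic (↥(maximalRealSubfield L)) L (IsCMField.complexConj L) N (Matrix.diagonal dV)
          (archSingle (↥(maximalRealSubfield L)) L (IsCMField.complexConj L) N (Matrix.diagonal dV)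
            (IsCMField.complexConj_ne_one L) (complexConj_smul_infinitePlace L) (cmPlaceOver L b) u), 1)
        (piSchwartzBruhatEquiv (↥(maximalRealSubfield L)) (Fin n) (Φinf ⊗ₜ[ℂ] f)) =
      piSchwartzBruhatEquiv (↥(maximalRealSubfield L)) (Fin n) (Φinf ⊗ₜ[ℂ] f) :=
  cmPairRepTwist_archSingle_one_eq_self L e dV hdV hdV0 dW hdW hdW0 hGR χV χW (cmPlaceOver L b) hnV
    (cmPairRep_archSingle_one_tmul_eq_det_zpow_smul L e dV hdV hdV0 dW hdW hdW0 hGR b hΦ f) hn u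

end Twist

/-! ## §5 Headline: (c5) at every definite place from sign facts, for every normalisation of the prescribed type -/

section Headline

variable (L : Type) [Field L] [NumberField L] [IsCMField L] {N M n : ℕ} (e : Fin N × Fin M ≃ Fin n)
variable (dV : Fin N → L) (hdV : ∀ i, IsCMField.complexConj L (dV i) = dV i) (hdV0 : ∀ i, dV i ≠ 0)
variable (dW : Fin M → L) (hdW : ∀ i, IsCMField.complexConj L (dW i) = dW i) (hdW0 : ∀ i, dW i ≠ 0)
variable (hGR : (cmSplittingDatum L e dV hdV hdV0 dW hdW hdW0).CompatibleSplitting)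


-- port_pkg: scope closed for this part
end Headline
end HodgeCM.Model.HypCensus
end
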